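import Summits.CriticalPhenomena.PercolationContinuityZ3.Theorems.PercNearOneGluingNoHeavyLowerTailSahiMixtureHereditary

/-!
# The GENERIC three-slot cell of the hereditary mixture programme: "P off the coin, Q on the coin" — exact Bernstein form, the co-monotone
# case is a theorem, and every three-slot H-MIX cell (any n) is an instance

Support file of the one-cut programme (crux `NoHeavyLowerTail`, stmt-CriticalPhenomena-4575; cell `prim-masterthm`, seat P3, gen 6;
`run/shared/lean/prim/prim-masterthm/prim-masterthm-p3/HIERARCHY.md` §13).  By the irredundant reduction (`…SahiMixtureIrredundant`) the hereditary mixture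
statement H-MIX(n) is decided by cells with `m ≤ n` slots; every slot of such a cell is a member `B_K = A_K ∪ (H ∩ A_{K∖F})` of the ∩-closed family of the
OR-mixed events, i.e. an event of the form **`mixEv P Q` = "`P` off the coin, `Q` on the coin"** with `P = A_K ⊆ Q = A_{K∖F}` (`biInter_orCoin_eq_mixEv`).
Block moments are `(1−h)·μ(⋂_B P_j) + h·μ(⋂_B Q_j)`, so a cell depends only on the `2m` events `P_j ⊆ Q_j`.  This file treats `m = 3` completely explicitly:
* `sahiE_three_mixEv_eq` — `E_3(μ⊗coin(h); mixEv P_j Q_j) = (1−h)³E_3(P) + h(1−h)²·C₁ + h²(1−h)·C₂ + h³E_3(Q)` with `C₁, C₂` explicit cubics in the 14 moments;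
* the STRUCTURE of the middle coefficients (two-point block form, HIERARCHY §13(f)):
  `C₁ = 2E_3(P) + E_3(Q) + Σ_iΨ_i + B₁`,  `C₂ = E_3(P) + 2E_3(Q) + Σ_iΨ_i + B₂`,
  `Ψ_i = (μQ_i − μP_i)·(Cov(Q_j,Q_k) − Cov(P_j,P_k))`,  `B₁ = d_2(q_0q_1 − p_0p_1) + q_2d_0d_1 ≥ 0`,  `B₂ = Σ_{i<j} d_id_jp_k + d_0d_1d_2 ≥ 0` (`d_j = q_j − p_j ≥ 0`);
* **`bernsteinPos_three_mixEv_of_comonotone`** — hence the cell is Bernstein-positive of degree 3 whenever `E_3(P), E_3(Q) ≥ 0` and the pairs are CO-MONOTONE,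
  `Cov(P_j,P_k) ≤ Cov(Q_j,Q_k)` (ttrl cp-mix's diagnostic MIXCOMB §13.6: the derived H-MIX(4) cells `(A_01,A_2,A_3)`, `F = 01` or `2`, … are of this kind —
  termwise nonnegative);
* the general case needs a certificate on the hereditary rows of the six events (the `n = 3` instance is gen 4's `T = Cov(A_0A_1,A_2) + μ(A_2Ā_0Ā_1) ≥ 0`):
  CONJECTURE GC(3), numerically clean on random hereditary configurations (this seat, 1 350 laws), asked of cp-mix as ONE generic LP over the 27 atom types
  — it would settle every three-slot H-MIX cell for every `n` at once (with the four-slot singleton cells: H-MIX(4)).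
HONEST FRAMING: GC(3) in general and H-MIX are open. [this work]
-/

noncomputable section

open scoped Classical

namespace Summit.CriticalPhenomena.PercolationContinuityZ3.Theorems

open Finset Function
open Literature.Combinatorics.Sahi2008
open Literature.Probability.Percolation.BHK2006 (ind_le_one)
open Literature.Probability.Percolation.DecisionTree (ind ind_of_mem ind_of_not_mem ind_nonneg)

namespace SahiMixture

/-! ### "P off the coin, Q on the coin" -/

section MixEv

variable {α : Type*} [Fintype α]

/-- The event of `α × Bool` that is `P` off the coin and `Q` on the coin. [this work] -/
def mixEv (P Q : Set α) : Set (α × Bool) := {x | (x.2 = false ∧ x.1 ∈ P) ∨ (x.2 = true ∧ x.1 ∈ Q)}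

omit [Fintype α] in
/-- Off the coin `mixEv P Q` is `P`. [this work] -/
@[simp] theorem ind_mixEv_false (P Q : Set α) (a : α) : ind (mixEv P Q) (a, false) = ind P a := by
  by_cases ha : a ∈ P <;> simp [mixEv, ind_of_mem, ind_of_not_mem, ha]

omit [Fintype α] in
/-- On the coin `mixEv P Q` is `Q`. [this work] -/
@[simp] theorem ind_mixEv_true (P Q : Set α) (a : α) : ind (mixEv P Q) (a, true) = ind Q a := by
  by_cases ha : a ∈ Q <;> simp [mixEv, ind_of_mem, ind_of_not_mem, ha]

omit [Fintype α] in
/-- **Every member of the ∩-closed family of OR-mixed events is a `mixEv`**: `⋂_{i∈K}(A_i ∪ [F i]·H) = mixEv (A_K) (A_{K∖F})`. [this work] -/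
theorem biInter_orCoin_eq_mixEv {n : ℕ} (A : Fin n → Set α) (F : Fin n → Bool) (K : Finset (Fin n)) :
    (⋂ i ∈ K, orCoin (A i) (F i)) = mixEv (⋂ i ∈ K, A i) (⋂ i ∈ K.filter (fun i => F i = false), A i) := by
  ext x
  obtain ⟨a, ξ⟩ := x
  cases ξ
  · simp [mixEv, orCoin, Set.mem_iInter, Finset.mem_filter]
  · simp only [mixEv, orCoin, Set.mem_iInter, Set.mem_setOf_eq, Finset.mem_filter, Bool.true_eq_false, false_and, true_and,
      false_or, and_imp]
    exact forall₂_congr fun i _ => by cases F i <;> simp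

variable (μ : α → ℝ) (h : ℝ)

/-- First coin moment of a `mixEv`. [this work] -/
theorem exm₁ (P Q : Set α) : ex (coinWeight μ h) (ind (mixEv P Q)) = (1 - h) * ex μ (ind P) + h * ex μ (ind Q) := by
  rw [ex_coinWeight]; simp

/-- Second coin moment of `mixEv`s. [this work] -/
theorem exm₂ (P Q P' Q' : Set α) :
    ex (coinWeight μ h) (ind (mixEv P Q) * ind (mixEv P' Q')) = (1 - h) * ex μ (ind P * ind P') + h * ex μ (ind Q * ind Q') := by
  rw [ex_coinWeight]; congr 2 <;> (congr 1; funext a; simp)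

/-- Third coin moment of `mixEv`s. [this work] -/
theorem exm₃ (P Q P' Q' P'' Q'' : Set α) :
    ex (coinWeight μ h) (ind (mixEv P Q) * ind (mixEv P' Q') * ind (mixEv P'' Q''))
      = (1 - h) * ex μ (ind P * ind P' * ind P'') + h * ex μ (ind Q * ind Q' * ind Q'') := by
  rw [ex_coinWeight]; congr 2 <;> (congr 1; funext a; simp)

end MixEv

/-! ### The generic three-slot cell -/

section Three

variable {α : Type*} [Fintype α] {μ : α → ℝ} (hμ : ∀ a, 0 ≤ μ a) (P0 P1 P2 Q0 Q1 Q2 : Set α)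

/-- **The generic three-slot cell in Bernstein form**: `E_3 = (1−h)³E_3(P) + h(1−h)²C₁ + h²(1−h)C₂ + h³E_3(Q)` with explicit `C₁, C₂` (cubics in the fourteen moments
`μ(⋂_S P_j)`, `μ(⋂_S Q_j)`). [this work] -/
theorem sahiE_three_mixEv_eq (h : ℝ) :
    sahiE (coinWeight μ h) 3 ![ind (mixEv P0 Q0), ind (mixEv P1 Q1), ind (mixEv P2 Q2)]
      = (1 - h) ^ 3 * sahiE μ 3 ![ind P0, ind P1, ind P2]
        + h * (1 - h) ^ 2 * (ex μ (ind P0) * ex μ (ind P1) * ex μ (ind Q2) + ex μ (ind P0) * ex μ (ind P2) * ex μ (ind Q1) + (-1) * ex μ (ind P0) * ex μ (ind P1 * ind P2) + (-1) * ex μ (ind P0) * ex μ (ind Q1 * ind Q2) + ex μ (ind P1) * ex μ (ind P2) * ex μ (ind Q0) + (-1) * ex μ (ind P1) * ex μ (ind P0 * ind P2) + (-1) * ex μ (ind P1) * ex μ (ind Q0 * ind Q2) + (-1) * ex μ (ind P0 * ind P1) * ex μ (ind P2) + (-1) * ex μ (ind P0 * ind P1) * ex μ (ind Q2) + (-1)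 * ex μ (ind P2) * ex μ (ind Q0 * ind Q1) + (-1) * ex μ (ind P0 * ind P2) * ex μ (ind Q1) + (-1) * ex μ (ind P1 * ind P2) * ex μ (ind Q0) + 4 * ex μ (ind P0 * ind P1 * ind P2) + 2 * ex μ (ind Q0 * ind Q1 * ind Q2))
        + h ^ 2 * (1 - h) * (ex μ (ind P0) * ex μ (ind Q1) * ex μ (ind Q2) + (-1) * ex μ (ind P0) * ex μ (ind Q1 * ind Q2) + ex μ (ind P1) * ex μ (ind Q0) * ex μ (ind Q2) + (-1) * ex μ (ind P1) * ex μ (ind Q0 * ind Q2) + (-1) * ex μ (ind P0 * ind P1) * ex μ (ind Q2) + ex μ (ind P2) * ex μ (ind Q0) * ex μ (ind Q1) + (-1) * ex μ (ind P2) * ex μ (ind Q0 * ind Q1) + (-1) * ex μ (ind P0 * ind P2) * ex μ (ind Q1) + (-1) * ex μ (ind P1 * ind P2) * ex μ (ind Q0) + 2 * ex μ (ind P0 * ind P1 * ind P2) + (-1) * ex μ (ind Q0) * ex μ (ind Q1 * ind Q2) + (-1) * ex μ (ind Q1) * ex μ (ind Q0 * ind Q2) + (-1) * ex μ (ind Q0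 * ind Q1) * ex μ (ind Q2) + 4 * ex μ (ind Q0 * ind Q1 * ind Q2))
        + h ^ 3 * sahiE μ 3 ![ind Q0, ind Q1, ind Q2] := by
  rw [sahiE_three, sahiE_three, sahiE_three]
  simp only [exm₃, exm₂, exm₁]
  ring

include hμ in
/-- **The co-monotone case of the generic three-slot cell.**  If `P_j ⊆ Q_j`, `E_3(P) ≥ 0`, `E_3(Q) ≥ 0` and the pairs are co-monotone
(`Cov(P_j,P_k) ≤ Cov(Q_j,Q_k)`), the cell is Bernstein-positive of degree `3`: `C₁ = 2E_3(P) + E_3(Q) + ΣΨ_i + B₁`, `C₂ = E_3(P) + 2E_3(Q) + ΣΨ_i + B₂` with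
`Ψ_i = (μQ_i − μP_i)(Cov(Q_j,Q_k) − Cov(P_j,P_k)) ≥ 0` and `B₁, B₂` products of probabilities. [this work] -/
theorem bernsteinPos_three_mixEv_of_comonotone (h0 : P0 ⊆ Q0) (h1 : P1 ⊆ Q1) (h2 : P2 ⊆ Q2)
    (hEP : 0 ≤ sahiE μ 3 ![ind P0, ind P1, ind P2]) (hEQ : 0 ≤ sahiE μ 3 ![ind Q0, ind Q1, ind Q2])
    (hc01 : ex μ (ind P0 * ind P1) - ex μ (ind P0) * ex μ (ind P1) ≤ ex μ (ind Q0 * ind Q1) - ex μ (ind Q0) * ex μ (ind Q1))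
    (hc02 : ex μ (ind P0 * ind P2) - ex μ (ind P0) * ex μ (ind P2) ≤ ex μ (ind Q0 * ind Q2) - ex μ (ind Q0) * ex μ (ind Q2))
    (hc12 : ex μ (ind P1 * ind P2) - ex μ (ind P1) * ex μ (ind P2) ≤ ex μ (ind Q1 * ind Q2) - ex μ (ind Q1) * ex μ (ind Q2)) :
    BernsteinPos 3 (fun h => sahiE (coinWeight μ h) 3 ![ind (mixEv P0 Q0), ind (mixEv P1 Q1), ind (mixEv P2 Q2)]) := by
  -- moments and their elementary inequalities
  have p0n : 0 ≤ ex μ (ind P0) := ex_nonneg hμ (ind_nonneg _)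
  have p1n : 0 ≤ ex μ (ind P1) := ex_nonneg hμ (ind_nonneg _)
  have p2n : 0 ≤ ex μ (ind P2) := ex_nonneg hμ (ind_nonneg _)
  have q2n : 0 ≤ ex μ (ind Q2) := ex_nonneg hμ (ind_nonneg _)
  have d0 : 0 ≤ ex μ (ind Q0) - ex μ (ind P0) :=
    sub_nonneg.2 (ex_mono hμ fun a => by
      by_cases ha : a ∈ P0
      · rw [ind_of_mem ha, ind_of_mem (h0 ha)]
      · rw [ind_of_not_mem ha]; exact ind_nonneg _ _)
  have d1 : 0 ≤ ex μ (ind Q1) - ex μ (ind P1) :=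
    sub_nonneg.2 (ex_mono hμ fun a => by
      by_cases ha : a ∈ P1
      · rw [ind_of_mem ha, ind_of_mem (h1 ha)]
      · rw [ind_of_not_mem ha]; exact ind_nonneg _ _)
  have d2 : 0 ≤ ex μ (ind Q2) - ex μ (ind P2) :=
    sub_nonneg.2 (ex_mono hμ fun a => by
      by_cases ha : a ∈ P2
      · rw [ind_of_mem ha, ind_of_mem (h2 ha)]
      · rw [ind_of_not_mem ha]; exact ind_nonneg _ _)
  have hqq : 0 ≤ ex μ (ind Q0) * ex μ (ind Q1) - ex μ (ind P0) * ex μ (ind P1) := by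
    have := mul_le_mul (sub_nonneg.1 d0) (sub_nonneg.1 d1) p1n (p0n.trans (sub_nonneg.1 d0))
    linarith
  have hΨ0 : 0 ≤ (ex μ (ind Q0) - ex μ (ind P0)) * ((ex μ (ind Q1 * ind Q2) - ex μ (ind Q1) * ex μ (ind Q2))
      - (ex μ (ind P1 * ind P2) - ex μ (ind P1) * ex μ (ind P2))) := mul_nonneg d0 (sub_nonneg.2 hc12)
  have hΨ1 : 0 ≤ (ex μ (ind Q1) - ex μ (ind P1)) * ((ex μ (ind Q0 * ind Q2) - ex μ (ind Q0) * ex μ (ind Q2))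
      - (ex μ (ind P0 * ind P2) - ex μ (ind P0) * ex μ (ind P2))) := mul_nonneg d1 (sub_nonneg.2 hc02)
  have hΨ2 : 0 ≤ (ex μ (ind Q2) - ex μ (ind P2)) * ((ex μ (ind Q0 * ind Q1) - ex μ (ind Q0) * ex μ (ind Q1))
      - (ex μ (ind P0 * ind P1) - ex μ (ind P0) * ex μ (ind P1))) := mul_nonneg d2 (sub_nonneg.2 hc01)
  have hB1 : 0 ≤ (ex μ (ind Q2) - ex μ (ind P2)) * (ex μ (ind Q0) * ex μ (ind Q1) - ex μ (ind P0) * ex μ (ind P1))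
      + ex μ (ind Q2) * (ex μ (ind Q0) - ex μ (ind P0)) * (ex μ (ind Q1) - ex μ (ind P1)) := by positivity
  have hB2 : 0 ≤ (ex μ (ind Q0) - ex μ (ind P0)) * (ex μ (ind Q1) - ex μ (ind P1)) * ex μ (ind P2)
      + (ex μ (ind Q0) - ex μ (ind P0)) * (ex μ (ind Q2) - ex μ (ind P2)) * ex μ (ind P1)
      + (ex μ (ind Q1) - ex μ (ind P1)) * (ex μ (ind Q2) - ex μ (ind P2)) * ex μ (ind P0)
      + (ex μ (ind Q0) - ex μ (ind P0)) * (ex μ (ind Q1) - ex μ (ind P1)) * (ex μ (ind Q2) - ex μ (ind P2)) := by positivity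
  rw [sahiE_three] at hEP hEQ
  have hc1 : 0 ≤ ex μ (ind P0) * ex μ (ind P1) * ex μ (ind Q2) + ex μ (ind P0) * ex μ (ind P2) * ex μ (ind Q1) + (-1) * ex μ (ind P0) * ex μ (ind P1 * ind P2) + (-1) * ex μ (ind P0) * ex μ (ind Q1 * ind Q2) + ex μ (ind P1) * ex μ (ind P2) * ex μ (ind Q0) + (-1) * ex μ (ind P1) * ex μ (ind P0 * ind P2) + (-1) * ex μ (ind P1) * ex μ (ind Q0 * ind Q2) + (-1) * ex μ (ind P0 * ind P1) * ex μ (ind P2) + (-1) * ex μ (ind P0 * ind P1) * ex μ (ind Q2) + (-1) * ex μ (ind P2) * ex μ (ind Q0 * ind Q1) + (-1) * ex μ (ind P0 * ind P2) * ex μ (ind Q1) + (-1) * ex μ (ind P1 * ind P2) * ex μ (ind Q0) + 4 * ex μ (ind P0 * ind P1 * ind P2) + 2 * ex μ (ind Q0 * ind Q1 * ind Q2) := by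
    nlinarith [hEP, hEQ, hΨ0, hΨ1, hΨ2, hB1]
  have hc2 : 0 ≤ ex μ (ind P0) * ex μ (ind Q1) * ex μ (ind Q2) + (-1) * ex μ (ind P0) * ex μ (ind Q1 * ind Q2) + ex μ (ind P1) * ex μ (ind Q0) * ex μ (ind Q2) + (-1) * ex μ (ind P1) * ex μ (ind Q0 * ind Q2) + (-1) * ex μ (ind P0 * ind P1) * ex μ (ind Q2) + ex μ (ind P2) * ex μ (ind Q0) * ex μ (ind Q1) + (-1) * ex μ (ind P2) * ex μ (ind Q0 * ind Q1) + (-1) * ex μ (ind P0 * ind P2) * ex μ (ind Q1) + (-1) * ex μ (ind P1 * ind P2) * ex μ (ind Q0) + 2 * ex μ (ind P0 * ind P1 * ind P2) + (-1) * ex μ (ind Q0) * ex μ (ind Q1 * ind Q2) + (-1) * ex μ (ind Q1) * ex μ (ind Q0 * ind Q2) + (-1) * ex μ (ind Q0 * ind Q1) * ex μ (ind Q2) + 4 * ex μ (ind Q0 * ind Q1 * ind Q2) := by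
    nlinarith [hEP, hEQ, hΨ0, hΨ1, hΨ2, hB2]
  have hc0 : 0 ≤ sahiE μ 3 ![ind P0, ind P1, ind P2] := by rw [sahiE_three]; exact hEP
  have hc3 : 0 ≤ sahiE μ 3 ![ind Q0, ind Q1, ind Q2] := by rw [sahiE_three]; exact hEQ
  refine ((((bp_g3.smul hc0).add (bp_hg2.smul hc1)).add (bp_h2g.smul hc2)).add (bp_h3.smul hc3)).congr fun h _ _ => ?_
  rw [sahiE_three_mixEv_eq P0 P1 P2 Q0 Q1 Q2 h]
  ring

end Three

end SahiMixture

end Summit.CriticalPhenomena.PercolationContinuityZ3.Theorems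

end
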